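import Summits.BirchSwinnertonDyer.BirchSwinnertonDyer.Theorems.CMKolyvaginAtInertTwoAdaptiveDataTelescopeStepMemW
import HarnessLib

/-!
# Route `CMKolyvaginAtInertTwo`, crux `CMKolyvaginExactAtInertTwo` (stmt-BirchSwinnertonDyer-24277):
# THE ADAPTIVE SPLIT-FORM TELESCOPE WITH THE KILL CLAUSE, II — McCallum's induction and T4
# `#Zp · #Zm ≤ p^{M₀}` with `hCTV` asked only on the isotropic subgroup `Zp ⊔ Zm`

Seat `bsd-line-cmk2-p1` g17 (cell `bsd-print-cf2`); helper (`--supports stmt-BirchSwinnertonDyer-24277`).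
THEOREMS ONLY: no definition, no named fact, no `sorry`; no item is closed; BSD is not proved by this.
Sequel of `…AdaptiveDataTelescopeStepMemW` (the step `adaptive_step_memW`); see its docstring for
WHY (T2 kit interface repair: the member formulas over `ℚ` need the test class killed by `2^L`, which
only classes of the lift groups are). This file re-runs seat g13's `card_mul_card_mul_pow_le` /
`card_mul_card_le_of_casselsTate_adaptive` (p676744) with the Cassels–Tate value formula `hCTV`
weakened to arguments in `W` (induction) resp. `Zp ⊔ Zm` (T4) — proofs VERBATIM otherwise:

* `card_mul_card_mul_pow_le_memW` — the induction on the measure `2(#Act + #Pas) + [Act = ⊥]`;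
* `card_mul_card_le_of_casselsTate_adaptive_memW` — **T4 with the kill clause**: for finite
  isotropic lift groups `Zp ≤ Sel ∩ V^{ε}`, `Zm ≤ Sel ∩ V^{−ε}` with `ℤx ⊓ (Zp ⊔ Zm) = ⊥`, (IND)
  `(Zp ⊔ Δ) ⊓ Zm = ⊥`, room `expo + M₀ ≤ M`, `hCTV` ON `Zp ⊔ Zm` and the order-form binder `hCeb₂`:
  `#Zp · #Zm ≤ p^{M₀}`.

Consumer: `KolyvaginPairDataTwo.card_mul_card_le_two_pow_two_mul_of_injective_of_kill` (the pair
assembly with `(p^k) • t = 0` exposed to the member formulas).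

References: [McCallumLMS1991] §1 Theorem; §5 Thm. 5.4 (proof, (16)–(23)), Cor. 5.6, Prop. 4.7,
Lemma 5.3, Prop. 3.1 / Cor. 3.2 (held `book:editornd-l-functions-arithmetic`, PDF pp. 280, 283–290).
-/

-- single-conjunct summit: `Summit.BirchSwinnertonDyer.BirchSwinnertonDyer.…` repeats the name by design
set_option linter.dupNamespace false
set_option autoImplicit false

open scoped Classical

namespace Summit.BirchSwinnertonDyer.BirchSwinnertonDyer.Theorems.KolyvaginAdaptiveData

open Literature.NumberTheory.EllipticCurves Literature.NumberTheory.EllipticCurves.KolyvaginDescent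

variable {V : Type*} [AddCommGroup V] {Pl : Type*}

/-! ## The chain with adaptive pools, `hCTV` on `W` -/

/-- **McCallum 1991, proof of Thm. 5.4 — the chain with ADAPTIVE pools over `SplitDataM`, the
Cassels–Tate value formula asked only for both arguments in the isotropic subgroup `W`.** Same
statement as `card_mul_card_mul_pow_le` otherwise: for every state (finite pools `Act`, `Pas` in `W`
of the right signs, mutually disjoint modulo `Δ`, a chain `n`, used exponent `Sg`, (19)/(23) and the
invariant (I)) one has `#Act · #Pas · p^{Sg} ≤ p^{M₀}`. Step: `adaptive_step_memW`.
[cite: McCallumLMS1991, §5 Thm. 5.4 (proof, (16)–(23)), Cor. 5.6 (PDF pp. 288–290)] -/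
theorem card_mul_card_mul_pow_le_memW (S : SplitDataM V Pl) (W : AddSubgroup V) {R : Type*}
    [AddCommGroup R] (P : S.Sel →+ S.Sel →+ R)
    (hCTV : ∀ ℓ m : ℕ, S.Kol ℓ → KolSupp S.Kol (ℓ * m) → ¬ ℓ ∣ m →
      ∀ (j N a b : ℕ) (t : V) (ht : t ∈ S.Sel) (hz : ((S.p : ℤ) ^ j) • S.c (ℓ * m) ∈ S.Sel),
      ((S.p : ℤ) ^ j) • S.c (ℓ * m) ∈ W → t ∈ W →
      ((S.p : ℤ) ^ N) • t = 0 → t ∈ S.eig (S.ε * (-1) ^ (ℓ * m).primeFactors.card) →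
      (∀ q ∈ m.primeFactors, t ∈ S.A q) → S.M - S.M₀ ≤ j → N + S.M₀ ≤ S.M → N ≤ j → a + b + 1 = N →
      ((S.p : ℤ) ^ (a + (j - N))) • S.c m ∉ S.A ℓ → ((S.p : ℤ) ^ b) • t ∉ S.A ℓ →
      P ⟨_, hz⟩ ⟨t, ht⟩ ≠ 0)
    (Δ : AddSubgroup V)
    (hΔpure : ∀ d ∈ Δ, ∀ e : ℤ, (e = 1 ∨ e = -1) → d ∈ S.eig e → d = 0)
    (hCeb₂ : ∀ (T : Finset V) (g₁ g₂ : V) (ν : ℤ) (I : ℕ), (ν = 1 ∨ ν = -1) → g₁ ∈ S.eig ν →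
      g₂ ∈ S.eig (-ν) → (∀ t ∈ T, ∃ e : ℤ, (e = 1 ∨ e = -1) ∧ t ∈ S.eig e) →
      (g₁ ≠ 0 → ((S.p : ℤ) ^ (S.expo g₁ - 1)) • g₁ ∉ Δ ⊔ AddSubgroup.closure (T : Set V)) →
      (1 ≤ I → ∀ d ∈ Δ, ∀ u ∈ AddSubgroup.closure (T : Set V), u ∈ S.eig (-ν) →
        ∀ v ∈ AddSubgroup.closure (T : Set V), v ∈ S.eig ν → (S.p : ℤ) • v = 0 →
        ((S.p : ℤ) ^ (I - 1)) • g₂ ≠ d + u + v) →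
      ∀ b : ℕ, ∃ ℓ, b < ℓ ∧ S.Kol ℓ ∧
        (∀ t ∈ AddSubgroup.closure (T : Set V), t ∈ S.A ℓ) ∧
        (∀ j < S.expo g₁, ((S.p : ℤ) ^ j) • g₁ ∉ S.A ℓ) ∧
        (∀ i < I, ((S.p : ℤ) ^ i) • g₂ ∉ S.A ℓ))
    (hWSel : W ≤ S.Sel)
    (hiso : ∀ u, ∀ hu : u ∈ W, ∀ v, ∀ hv : v ∈ W, ∀ (hu' : u ∈ S.Sel) (hv' : v ∈ S.Sel),
      P ⟨u, hu'⟩ ⟨v, hv'⟩ = 0)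
    (hroom : ∀ z ∈ W, S.expo z + S.M₀ ≤ S.M) :
    ∀ (m : ℕ) (Act Pas : AddSubgroup V) [Finite Act] [Finite Pas], Act ≤ W → Pas ≤ W →
      Disjoint Act (Pas ⊔ Δ) → Disjoint Pas (Act ⊔ Δ) →
      ∀ n : ℕ, KolSupp S.Kol n → ∀ Sg : ℕ,
      (∀ z ∈ Act, z ∈ S.eig (S.ε * (-1) ^ (n.primeFactors.card + 1))) →
      (∀ u ∈ Pas, u ∈ S.eig (S.ε * (-1) ^ n.primeFactors.card)) →
      (∀ q ∈ n.primeFactors, ∀ z ∈ Act ⊔ Pas, z ∈ S.A q) →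
      (∀ i : ℕ, ((S.p : ℤ) ^ i) • S.c n ∈ Act ⊔ Pas → (S.M - S.M₀) + Sg ≤ i) →
      2 * (Nat.card Act + Nat.card Pas) + (if Act = ⊥ then 1 else 0) ≤ m →
      Nat.card Act * Nat.card Pas * S.p ^ Sg ≤ S.p ^ S.M₀ := by
  have hp := S.hp
  intro m
  induction m with
  | zero =>
    intro Act Pas _ _ _ _ _ _ n _ Sg _ _ _ _ hm
    have : 0 < Nat.card Act := Nat.card_pos
    omega
  | succ m ih =>
    intro Act Pas _ _ hAct hPas hd1 hd2 n hn Sg hActν hPasν hA hI hm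
    by_cases hend : Act = ⊥ ∧ Pas = ⊥
    · -- END: both pools exhausted; (I) at `i = M` gives `Sg ≤ M₀`
      obtain ⟨hA0, hP0⟩ := hend
      have hSg : S.M - S.M₀ + Sg ≤ S.M := hI S.M (by rw [S.torsion]; exact zero_mem _)
      have hcA : Nat.card Act = 1 := by rw [hA0]; exact AddSubgroup.card_bot
      have hcP : Nat.card Pas = 1 := by rw [hP0]; exact AddSubgroup.card_bot
      rw [hcA, hcP, one_mul, one_mul]
      exact Nat.pow_le_pow_right hp.pos (by omega)
    · -- one Kolyvagin prime (`adaptive_step`), then recurse with the roles of the pools swapped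
      obtain ⟨ℓ, Z', e, -, hsupp, hcard', hZ'le, hcardAct, hene, hA', hI'⟩ :=
        adaptive_step_memW S W P hCTV Δ hΔpure hCeb₂ hWSel hiso hroom Act Pas hAct hPas hd1 hn Sg
          hActν hPasν hA hI
      haveI : Finite Z' :=
        Finite.of_injective (AddSubgroup.inclusion hZ'le) (AddSubgroup.inclusion_injective hZ'le)
      -- the new state `(Pas, Z')` at `ℓ n` with `Sg + e`
      have hd1' : Disjoint Pas (Z' ⊔ Δ) := hd2.mono_right (sup_le_sup_right hZ'le Δ)
      have hd2' : Disjoint Z' (Pas ⊔ Δ) := hd1.mono_left hZ'le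
      have hActν' : ∀ z ∈ Pas, z ∈ S.eig (S.ε * (-1) ^ ((ℓ * n).primeFactors.card + 1)) := by
        intro z hz
        have : S.ε * (-1) ^ ((ℓ * n).primeFactors.card + 1) = S.ε * (-1) ^ n.primeFactors.card := by
          rw [hcard']
          ring
        rw [this]
        exact hPasν z hz
      have hPasν' : ∀ u ∈ Z', u ∈ S.eig (S.ε * (-1) ^ (ℓ * n).primeFactors.card) := by
        intro u hu
        rw [hcard']
        exact hActν u (hZ'le hu)
      have hAI : ∀ q ∈ (ℓ * n).primeFactors, ∀ z ∈ Pas ⊔ Z', z ∈ S.A q := by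
        intro q hq z hz
        rw [sup_comm] at hz
        exact hA' q hq z hz
      have hII : ∀ i : ℕ, ((S.p : ℤ) ^ i) • S.c (ℓ * n) ∈ Pas ⊔ Z' →
          (S.M - S.M₀) + (Sg + e) ≤ i := by
        intro i hi
        rw [sup_comm] at hi
        exact hI' i hi
      -- the measure drops
      have hcZ' : 0 < Nat.card Z' := Nat.card_pos
      have hmeas : 2 * (Nat.card Pas + Nat.card Z') + (if Pas = ⊥ then 1 else 0) ≤ m := by
        by_cases hA0 : Act = ⊥
        · -- dummy step: the roles swap, `[Act = ⊥]` drops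
          have hP0 : Pas ≠ ⊥ := fun h ↦ hend ⟨hA0, h⟩
          have hcA : Nat.card Act = 1 := by rw [hA0]; exact AddSubgroup.card_bot
          have hZ'bot : Z' = ⊥ := by rw [← le_bot_iff, ← hA0]; exact hZ'le
          have hcZ : Nat.card Z' = 1 := by rw [hZ'bot]; exact AddSubgroup.card_bot
          rw [if_pos hA0] at hm
          rw [if_neg hP0]
          omega
        · -- real step: `#Z' ≤ #Act / p`
          have he : e ≠ 0 := hene hA0
          have h2 : 2 * Nat.card Z' ≤ Nat.card Act := by
            rw [hcardAct]
            exact Nat.mul_le_mul_right _ (Nat.succ_le_of_lt (Nat.one_lt_pow he hp.one_lt))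
          rw [if_neg hA0] at hm
          split_ifs <;> omega
      have hrec := ih Pas Z' hPas (hZ'le.trans hAct) hd1' hd2' (ℓ * n) hsupp (Sg + e) hActν' hPasν'
        hAI hII hmeas
      calc Nat.card Act * Nat.card Pas * S.p ^ Sg
          = Nat.card Pas * Nat.card Z' * S.p ^ (Sg + e) := by rw [hcardAct, pow_add]; ring
        _ ≤ S.p ^ S.M₀ := hrec

/-! ## T4 with the kill clause: `#Zp · #Zm ≤ p^{M₀}` -/

/-- **T4 — McCallum 1991 Thm. 5.4 "≤" / Cor. 5.6 in telescope form over the data carrier `SplitDataM`,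
ADAPTIVE version, with the Cassels–Tate value formula `hCTV` asked ONLY for arguments in the isotropic
subgroup `Zp ⊔ Zm`** (displayed binders `p^j c(ℓm) ∈ Zp ⊔ Zm`, `t ∈ Zp ⊔ Zm`). Otherwise verbatim
`card_mul_card_le_of_casselsTate_adaptive`: `Zp ≤ Sel ∩ V^{ε}`, `Zm ≤ Sel ∩ V^{−ε}` finite isotropic
lift groups, `ℤx ⊓ (Zp ⊔ Zm) = ⊥`, (IND) `(Zp ⊔ Δ) ⊓ Zm = ⊥`, room `expo z + M₀ ≤ M`, `Δ` pure-free,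
`hCeb₂` the order-form Čebotarev binder; then `#Zp · #Zm ≤ p^{M₀}`. In the `p = 2` pair assembly the
lift groups are killed by `2^k` (`k` the exponent of `Ш(E^{ε}/ℚ)[2^∞] ⊕ Sel(E^{−ε}/ℚ)`), which is
what the member formulas over `ℚ` need (`2^L • t = 0`, `L ≥ k`).
[cite: McCallumLMS1991, §1 Theorem; §5 Thm. 5.4 (proof, (16)–(23)), Cor. 5.6; Prop. 3.1 / Cor. 3.2, Prop. 4.7, Lemma 5.3 (PDF pp. 280, 283–290)] -/
theorem card_mul_card_le_of_casselsTate_adaptive_memW (S : SplitDataM V Pl) (Zp Zm : AddSubgroup V)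
    [Finite Zp] [Finite Zm] {R : Type*} [AddCommGroup R] (P : S.Sel →+ S.Sel →+ R)
    (hCTV : ∀ ℓ m : ℕ, S.Kol ℓ → KolSupp S.Kol (ℓ * m) → ¬ ℓ ∣ m →
      ∀ (j N a b : ℕ) (t : V) (ht : t ∈ S.Sel) (hz : ((S.p : ℤ) ^ j) • S.c (ℓ * m) ∈ S.Sel),
      ((S.p : ℤ) ^ j) • S.c (ℓ * m) ∈ Zp ⊔ Zm → t ∈ Zp ⊔ Zm →
      ((S.p : ℤ) ^ N) • t = 0 → t ∈ S.eig (S.ε * (-1) ^ (ℓ * m).primeFactors.card) →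
      (∀ q ∈ m.primeFactors, t ∈ S.A q) → S.M - S.M₀ ≤ j → N + S.M₀ ≤ S.M → N ≤ j → a + b + 1 = N →
      ((S.p : ℤ) ^ (a + (j - N))) • S.c m ∉ S.A ℓ → ((S.p : ℤ) ^ b) • t ∉ S.A ℓ →
      P ⟨_, hz⟩ ⟨t, ht⟩ ≠ 0)
    (Δ : AddSubgroup V)
    (hΔpure : ∀ d ∈ Δ, ∀ e : ℤ, (e = 1 ∨ e = -1) → d ∈ S.eig e → d = 0)
    (hCeb₂ : ∀ (T : Finset V) (g₁ g₂ : V) (ν : ℤ) (I : ℕ), (ν = 1 ∨ ν = -1) → g₁ ∈ S.eig ν →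
      g₂ ∈ S.eig (-ν) → (∀ t ∈ T, ∃ e : ℤ, (e = 1 ∨ e = -1) ∧ t ∈ S.eig e) →
      (g₁ ≠ 0 → ((S.p : ℤ) ^ (S.expo g₁ - 1)) • g₁ ∉ Δ ⊔ AddSubgroup.closure (T : Set V)) →
      (1 ≤ I → ∀ d ∈ Δ, ∀ u ∈ AddSubgroup.closure (T : Set V), u ∈ S.eig (-ν) →
        ∀ v ∈ AddSubgroup.closure (T : Set V), v ∈ S.eig ν → (S.p : ℤ) • v = 0 →
        ((S.p : ℤ) ^ (I - 1)) • g₂ ≠ d + u + v) →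
      ∀ b : ℕ, ∃ ℓ, b < ℓ ∧ S.Kol ℓ ∧
        (∀ t ∈ AddSubgroup.closure (T : Set V), t ∈ S.A ℓ) ∧
        (∀ j < S.expo g₁, ((S.p : ℤ) ^ j) • g₁ ∉ S.A ℓ) ∧
        (∀ i < I, ((S.p : ℤ) ^ i) • g₂ ∉ S.A ℓ))
    (hZp : ∀ z ∈ Zp, z ∈ S.Sel ∧ z ∈ S.eig S.ε) (hZm : ∀ z ∈ Zm, z ∈ S.Sel ∧ z ∈ S.eig (-S.ε))
    (hiso : ∀ u, ∀ hu : u ∈ Zp ⊔ Zm, ∀ v, ∀ hv : v ∈ Zp ⊔ Zm, ∀ (hu' : u ∈ S.Sel) (hv' : v ∈ S.Sel),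
      P ⟨u, hu'⟩ ⟨v, hv'⟩ = 0)
    (hind : AddSubgroup.zmultiples S.x ⊓ (Zp ⊔ Zm) = ⊥)
    (hIND : (Zp ⊔ Δ) ⊓ Zm = ⊥)
    (hroom : ∀ z ∈ Zp ⊔ Zm, S.expo z + S.M₀ ≤ S.M) :
    Nat.card Zp * Nat.card Zm ≤ S.p ^ S.M₀ := by
  have hp := S.hp
  have hWSel : Zp ⊔ Zm ≤ S.Sel := sup_le (fun z hz ↦ (hZp z hz).1) (fun z hz ↦ (hZm z hz).1)
  -- (IND) in the two forms the induction carries (`Δ ∩ V^{ε} = 0`)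
  have hd1 : Disjoint Zm (Zp ⊔ Δ) := by rw [disjoint_iff, inf_comm]; exact hIND
  have hd2 : Disjoint Zp (Zm ⊔ Δ) := by
    refine AddSubgroup.disjoint_def.mpr fun {a} haP haMD ↦ ?_
    obtain ⟨b, hb, d, hd, hbd⟩ := AddSubgroup.mem_sup.mp haMD
    have hb' : b ∈ (Zp ⊔ Δ) ⊓ Zm := by
      refine ⟨?_, hb⟩
      have : b = a - d := by rw [← hbd]; abel
      rw [this]
      exact (Zp ⊔ Δ).sub_mem (AddSubgroup.mem_sup_left haP) (AddSubgroup.mem_sup_right hd)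
    rw [hIND, AddSubgroup.mem_bot] at hb'
    rw [hb', zero_add] at hbd
    subst hbd
    exact hΔpure d hd S.ε S.hε (hZp d haP).2
  -- ### initial state: `n = 1`, `Sg = 0`, `Act = Zm` (sign `-ε`), `Pas = Zp` (sign `ε`)
  have hActν : ∀ z ∈ Zm, z ∈ S.eig (S.ε * (-1) ^ ((1 : ℕ).primeFactors.card + 1)) := by
    intro z hz
    rw [Nat.primeFactors_one, Finset.card_empty, zero_add, pow_one, mul_neg_one]
    exact (hZm z hz).2
  have hPasν : ∀ u ∈ Zp, u ∈ S.eig (S.ε * (-1) ^ (1 : ℕ).primeFactors.card) := by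
    intro u hu
    rw [Nat.primeFactors_one, Finset.card_empty, pow_zero, mul_one]
    exact (hZp u hu).2
  have hA : ∀ q ∈ (1 : ℕ).primeFactors, ∀ z ∈ Zm ⊔ Zp, z ∈ S.A q := by
    intro q hq
    simp at hq
  -- (I) at `n = 1`: `p^{i + M₀} x ∈ Zp ⊔ Zm ⟹ p^{i + M₀} x = 0 ⟹ M ≤ i + M₀` (independence of `ℤx`)
  have hI : ∀ i : ℕ, ((S.p : ℤ) ^ i) • S.c 1 ∈ Zm ⊔ Zp → (S.M - S.M₀) + 0 ≤ i := by
    intro i hi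
    rw [S.c_one, smul_smul, ← pow_add, sup_comm] at hi
    have hmem : ((S.p : ℤ) ^ (i + S.M₀)) • S.x ∈ AddSubgroup.zmultiples S.x ⊓ (Zp ⊔ Zm) :=
      ⟨AddSubgroup.zsmul_mem _ (AddSubgroup.mem_zmultiples S.x) _, hi⟩
    rw [hind, AddSubgroup.mem_bot, S.expo_x_and_zsmul_x_eq_zero_iff.2.2, ← Nat.cast_pow, ← Nat.cast_pow,
      Int.natCast_dvd_natCast, Nat.pow_dvd_pow_iff_le_right hp.one_lt] at hmem
    omega
  have key := card_mul_card_mul_pow_le_memW S (Zp ⊔ Zm) P hCTV Δ hΔpure hCeb₂ hWSel hiso hroom _ Zm Zp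
    le_sup_right le_sup_left hd1 hd2 1 (kolSupp_one _) 0 hActν hPasν hA hI le_rfl
  rw [pow_zero, mul_one, mul_comm] at key
  exact key

end Summit.BirchSwinnertonDyer.BirchSwinnertonDyer.Theorems.KolyvaginAdaptiveData
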